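import Summits.NavierStokesRegularity.NavierStokesRegularity.Theorems.TypeICertificateLadderTargetRssCompactness
import Summits.NavierStokesRegularity.NavierStokesRegularity.Theorems.TypeICertificateLadderTargetRssCompactnessReflection
import HarnessLib

/-!
# Crux `Target` (stmt-NavierStokesRegularity-1217), line `killing-twisted-bernoulli-solitons`,
  stub B5b `stub_windowLiouville`: the bad set in the `(C₀, α)` plane and a MINIMAL Type-I constant

Support file (theorems only, `--supports stmt-NavierStokesRegularity-1217`), second half of the
window-topology programme of `TypeICertificateLadderTargetRssCompactness.lean` (notation as there:
a pair `(C₀, α)` is BAD if it carries a non-trivial Type-I (constant `C₀`) rotated self-similar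
classical solution of Pineau–Vicol's class with speed `α`; the Liouville property `L(C₀, α)` is its
negation).

* `rssCompact_not_liouvilleAt_of_tendsto` (registered) — limits of bad pairs are bad: the
  extraction `rssCompact_exists_limit` with VARYING constants `C_n → C⋆` and speeds `α_n → α⋆`,
  then `rssCompact_not_liouvilleAt_of_limit`;
* `rssCompact_isClosed_bad_pairs` — the bad set is closed in `ℝ²`;
* `rssCompact_exists_minimal_constant` (registered) — if any bad pair exists, there is a bad pair
  whose Type-I constant is MINIMAL among all bad pairs, and that constant is `> 0` (small constants
  are good, `rssCompact_good_of_small_constant`; minimising sequences have bounded speeds by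
  monotonicity and Theorem 1.4; limits of bad pairs are bad);
* `rssCompact_liouville_of_descent_speed` / `rssCompact_liouville_of_ascent_speed` — B5b at level
  `C₀` follows from DESCENT (or ASCENT) in `|α|`: every bad speed has a bad speed of strictly
  smaller (larger) modulus (by the extremal speeds of `rssCompact_exists_extremal_speeds`);
* `rssCompact_bad_neg_iff` — the bad set is symmetric under `α ↦ −α` (reflection,
  `rssCompact_liouvilleAt_neg` of `…RssCompactnessReflection.lean`);
* `rssCompact_liouville_of_isOpen_bad` — the clopen argument: an OPEN bad set at level `C₀` is
  empty (compact + open in the connected line, and `0` is never bad), i.e. a fixed-constant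
  perturbation theory of counterexamples would settle the level;
* `rssCompact_liouville_of_descent_constant` — hence Conj. 1.1 (in Pineau–Vicol's class, all levels
  and speeds) follows from DESCENT in the constant: every bad pair admits a bad pair with a strictly
  smaller constant.

Relation to route `ExtremalTypeIConstant`: its support item `MinimiserExists`
(stmt-NavierStokesRegularity-8217) is the RATE-CLASS analogue of `rssCompact_exists_minimal_constant`
(minimal Type-I constant among all non-trivial KNSS-mild ancient solutions, with attainment at
`(−1, 0)`); the present file is the scaling-SOLITON (RSS, Pineau–Vicol Rem. 1.8) counterpart, where
compactness modulo symmetries is automatic from the ansatz and no attainment normalisation is needed.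

Honest scope: structure only; B5b / Conj. 1.1 stay OPEN.

## References

* B. Pineau, V. Vicol, arXiv:2607.09619 (2026): Conj. 1.1, Remarks 1.2–1.3, Theorem 1.4.
  [PineauVicol2026]
* D. Chae, J. Wolf, Comm. PDE 42 (2017) 1359–1374 = arXiv:1610.09464, §3. [ChaeWolf2017RemovingDSS]
-/

noncomputable section

namespace Summit.NavierStokesRegularity.NavierStokesRegularity.Theorems

open MeasureTheory Set Function Filter Metric Real
open scoped Topology ENNReal NNReal ContDiff
open Literature.Analysis.FluidPDE Literature.Analysis.FluidPDE.PineauVicol2026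

section Pairs


/-- **Window Liouville by DESCENT in the speed.** For `C₀ > 0`: if every bad speed (one carrying a
non-trivial Type-I (constant `C₀`) RSS classical solution of Pineau–Vicol's class) admits a bad
speed of STRICTLY SMALLER modulus, then there is no bad speed at all — the Liouville property holds
at `(C₀, α)` for every `α` (a bad speed of least modulus would exist by
`rssCompact_exists_extremal_speeds`). A reformulation of stub B5b / Conj. 1.1 at level `C₀` as an
infinite-descent statement. [cite: PineauVicol2026, Conj. 1.1 and Theorem 1.4; ChaeWolf2017RemovingDSS, §3] -/
theorem rssCompact_liouville_of_descent_speed (C₀ : ℝ) (hC₀ : 0 < C₀)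
    (hdesc : ∀ α ∈ {α : ℝ | ∃ (u : ℝ → EuclideanSpace ℝ (Fin 3) → EuclideanSpace ℝ (Fin 3)) (p : ℝ → EuclideanSpace ℝ (Fin 3) → ℝ) (U : EuclideanSpace ℝ (Fin 3) → EuclideanSpace ℝ (Fin 3)),
        IsClassicalNSSolutionOn (Ico (-1) 0) 1 0 u p ∧
        (∀ t ∈ Ico (-1 : ℝ) 0, ∀ x : EuclideanSpace ℝ (Fin 3), ‖u t x‖ ≤ C₀ / (‖x‖ + Real.sqrt (-t))) ∧
        ContDiff ℝ 2 U ∧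
        (∀ t ∈ Ico (-1 : ℝ) 0, ∀ x : EuclideanSpace ℝ (Fin 3), u t x = pvAnsatz α (fun y _ => U y) t x) ∧ U ≠ 0},
      ∃ α' ∈ {α : ℝ | ∃ (u : ℝ → EuclideanSpace ℝ (Fin 3) → EuclideanSpace ℝ (Fin 3)) (p : ℝ → EuclideanSpace ℝ (Fin 3) → ℝ) (U : EuclideanSpace ℝ (Fin 3) → EuclideanSpace ℝ (Fin 3)),
        IsClassicalNSSolutionOn (Ico (-1) 0) 1 0 u p ∧
        (∀ t ∈ Ico (-1 : ℝ) 0, ∀ x : EuclideanSpace ℝ (Fin 3), ‖u t x‖ ≤ C₀ / (‖x‖ + Real.sqrt (-t))) ∧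
        ContDiff ℝ 2 U ∧
        (∀ t ∈ Ico (-1 : ℝ) 0, ∀ x : EuclideanSpace ℝ (Fin 3), u t x = pvAnsatz α (fun y _ => U y) t x) ∧ U ≠ 0},
        |α'| < |α|) :
    ∀ (α : ℝ) (u : ℝ → EuclideanSpace ℝ (Fin 3) → EuclideanSpace ℝ (Fin 3)) (p : ℝ → EuclideanSpace ℝ (Fin 3) → ℝ) (U : EuclideanSpace ℝ (Fin 3) → EuclideanSpace ℝ (Fin 3)),
        IsClassicalNSSolutionOn (Ico (-1) 0) 1 0 u p →
        (∀ t ∈ Ico (-1 : ℝ) 0, ∀ x : EuclideanSpace ℝ (Fin 3), ‖u t x‖ ≤ C₀ / (‖x‖ + Real.sqrt (-t))) →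
        ContDiff ℝ 2 U →
        (∀ t ∈ Ico (-1 : ℝ) 0, ∀ x : EuclideanSpace ℝ (Fin 3), u t x = pvAnsatz α (fun y _ => U y) t x) → U = 0 := by
  intro α u p U h1 h2 h3 h4
  by_contra h5
  obtain ⟨αmin, _, -, hmin_mem, -, hboth⟩ :=
    rssCompact_exists_extremal_speeds C₀ hC₀ ⟨α, u, p, U, h1, h2, h3, h4, h5⟩
  obtain ⟨α', hα', hlt⟩ := hdesc αmin hmin_mem
  exact (lt_irrefl _) (lt_of_lt_of_le hlt (hboth α' hα').1)

/-- **Window Liouville by ASCENT in the speed.** Dually: if every bad speed admits a bad speed of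
STRICTLY LARGER modulus, there is no bad speed at level `C₀`. [cite: PineauVicol2026, Conj. 1.1 and Theorem 1.4; ChaeWolf2017RemovingDSS, §3] -/
theorem rssCompact_liouville_of_ascent_speed (C₀ : ℝ) (hC₀ : 0 < C₀)
    (hasc : ∀ α ∈ {α : ℝ | ∃ (u : ℝ → EuclideanSpace ℝ (Fin 3) → EuclideanSpace ℝ (Fin 3)) (p : ℝ → EuclideanSpace ℝ (Fin 3) → ℝ) (U : EuclideanSpace ℝ (Fin 3) → EuclideanSpace ℝ (Fin 3)),
        IsClassicalNSSolutionOn (Ico (-1) 0) 1 0 u p ∧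
        (∀ t ∈ Ico (-1 : ℝ) 0, ∀ x : EuclideanSpace ℝ (Fin 3), ‖u t x‖ ≤ C₀ / (‖x‖ + Real.sqrt (-t))) ∧
        ContDiff ℝ 2 U ∧
        (∀ t ∈ Ico (-1 : ℝ) 0, ∀ x : EuclideanSpace ℝ (Fin 3), u t x = pvAnsatz α (fun y _ => U y) t x) ∧ U ≠ 0},
      ∃ α' ∈ {α : ℝ | ∃ (u : ℝ → EuclideanSpace ℝ (Fin 3) → EuclideanSpace ℝ (Fin 3)) (p : ℝ → EuclideanSpace ℝ (Fin 3) → ℝ) (U : EuclideanSpace ℝ (Fin 3) → EuclideanSpace ℝ (Fin 3)),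
        IsClassicalNSSolutionOn (Ico (-1) 0) 1 0 u p ∧
        (∀ t ∈ Ico (-1 : ℝ) 0, ∀ x : EuclideanSpace ℝ (Fin 3), ‖u t x‖ ≤ C₀ / (‖x‖ + Real.sqrt (-t))) ∧
        ContDiff ℝ 2 U ∧
        (∀ t ∈ Ico (-1 : ℝ) 0, ∀ x : EuclideanSpace ℝ (Fin 3), u t x = pvAnsatz α (fun y _ => U y) t x) ∧ U ≠ 0},
        |α| < |α'|) :
    ∀ (α : ℝ) (u : ℝ → EuclideanSpace ℝ (Fin 3) → EuclideanSpace ℝ (Fin 3)) (p : ℝ → EuclideanSpace ℝ (Fin 3) → ℝ) (U : EuclideanSpace ℝ (Fin 3) → EuclideanSpace ℝ (Fin 3)),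
        IsClassicalNSSolutionOn (Ico (-1) 0) 1 0 u p →
        (∀ t ∈ Ico (-1 : ℝ) 0, ∀ x : EuclideanSpace ℝ (Fin 3), ‖u t x‖ ≤ C₀ / (‖x‖ + Real.sqrt (-t))) →
        ContDiff ℝ 2 U →
        (∀ t ∈ Ico (-1 : ℝ) 0, ∀ x : EuclideanSpace ℝ (Fin 3), u t x = pvAnsatz α (fun y _ => U y) t x) → U = 0 := by
  intro α u p U h1 h2 h3 h4
  by_contra h5
  obtain ⟨_, αmax, -, -, hmax_mem, hboth⟩ :=
    rssCompact_exists_extremal_speeds C₀ hC₀ ⟨α, u, p, U, h1, h2, h3, h4, h5⟩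
  obtain ⟨α', hα', hlt⟩ := hasc αmax hmax_mem
  exact (lt_irrefl _) (lt_of_le_of_lt (hboth α' hα').2 hlt)

/-! ### The bad set in the `(C₀, α)` half-plane: closedness and a minimal constant -/

/-- **Limits of bad pairs are bad.** If `(C_n, α_n) → (C⋆, α⋆)` and every `(C_n, α_n)` carries a
non-trivial Type-I (constant `C_n`) RSS classical solution of Pineau–Vicol's class with speed
`α_n`, then the Liouville property FAILS at `(C⋆, α⋆)` (extraction `rssCompact_exists_limit` with
varying constants, then `rssCompact_not_liouvilleAt_of_limit`). In particular the bad set is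
closed in the `(C₀, α)` plane. [cite: ChaeWolf2017RemovingDSS, §3; PineauVicol2026, Theorem 1.4 (class)] -/
theorem rssCompact_not_liouvilleAt_of_tendsto :
    ∀ (C α : ℕ → ℝ) (Cstar αstar : ℝ), Filter.Tendsto C Filter.atTop (nhds Cstar) → Filter.Tendsto α Filter.atTop (nhds αstar) → (∀ n, ∃ (u : ℝ → EuclideanSpace ℝ (Fin 3) → EuclideanSpace ℝ (Fin 3)) (p : ℝ → EuclideanSpace ℝ (Fin 3) → ℝ) (U : EuclideanSpace ℝ (Fin 3) → EuclideanSpace ℝ (Fin 3)), Literature.Analysis.FluidPDE.IsClassicalNSSolutionOn (Set.Ico (-1) 0) 1 0 u p ∧ (∀ t ∈ Set.Ico (-1 : ℝ) 0, ∀ x : EuclideanSpace ℝ (Fin 3), ‖u t x‖ ≤ C n / (‖x‖ + Real.sqrt (-t))) ∧ ContDiff ℝ 2 U ∧ (∀ t ∈ Set.Ico (-1 : ℝ) 0, ∀ x : EuclideanSpace ℝ (Fin 3), u t x = Literature.Analysis.FluidPDE.pvAnsatz (α n) (fun y _ => U y) t x) ∧ U ≠ 0) → ¬ (∀ (u : ℝ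 → EuclideanSpace ℝ (Fin 3) → EuclideanSpace ℝ (Fin 3)) (p : ℝ → EuclideanSpace ℝ (Fin 3) → ℝ) (U : EuclideanSpace ℝ (Fin 3) → EuclideanSpace ℝ (Fin 3)), Literature.Analysis.FluidPDE.IsClassicalNSSolutionOn (Set.Ico (-1) 0) 1 0 u p → (∀ t ∈ Set.Ico (-1 : ℝ) 0, ∀ x : EuclideanSpace ℝ (Fin 3), ‖u t x‖ ≤ Cstar / (‖x‖ + Real.sqrt (-t))) → ContDiff ℝ 2 U → (∀ t ∈ Set.Ico (-1 : ℝ) 0, ∀ x : EuclideanSpace ℝ (Fin 3), u t x = Literature.Analysis.FluidPDE.pvAnsatz αstar (fun y _ => U y) t x) → U = 0) := by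
  intro C α Cstar αstar hC hα hbad
  choose u p U hsol hI _hU2 hans hne using hbad
  -- the constants are non-negative and uniformly bounded
  have hC0 : ∀ n, 0 ≤ C n := fun n => by
    have h := hI n (-1) ⟨le_rfl, by norm_num⟩ 0
    rw [norm_zero, zero_add, neg_neg, Real.sqrt_one, div_one] at h
    exact (norm_nonneg _).trans h
  obtain ⟨b, hb⟩ := hC.bddAbove_range
  set C₀ : ℝ := max b 1 with hC₀def
  have hC₀ : 0 < C₀ := lt_of_lt_of_le one_pos (le_max_right _ _)
  have hCle : ∀ n, C n ≤ C₀ := fun n =>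
    (hb (Set.mem_range_self n)).trans (le_max_left _ _)
  -- backward extensions with the constants `C n`
  have hext := fun n => rssCompact_extend (hsol n) (hI n) (hans n)
  choose P hP using fun n => (hext n).1
  have hIw : ∀ n, HasTypeIDecay (C n) (pvAnsatz (α n) (fun y _ => U n y)) := fun n => (hext n).2
  obtain ⟨v, hvc, hvI, hweak, hss, x, hx⟩ := rssCompact_exists_limit C₀ Cstar αstar C α U P hC₀ hC0 hCle
    hC hα hP hIw hne
  exact rssCompact_not_liouvilleAt_of_limit hvc hvI hweak hss ⟨x, hx⟩

/-- **A counterexample with MINIMAL Type-I constant.** If some pair `(C₀, α)` carries a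
non-trivial Type-I RSS classical solution of Pineau–Vicol's class (i.e. Conj. 1.1 fails in that
class), then among ALL such pairs there is one, `(C⋆, α⋆)`, whose constant is minimal, and
`C⋆ > 0` (indeed `C⋆ > ε₀`, Chae–Wolf's smallness constant, `rssCompact_good_of_small_constant`).
Proof: `C⋆ = inf` of the bad constants; a minimising sequence of bad pairs has bounded speeds
(monotonicity `rssCompact_liouvilleAt_anti` + the window `rssCompact_bad_subset_window` at the
largest constant), a subsequence of speeds converges, and the limit pair is bad
(`rssCompact_not_liouvilleAt_of_tendsto`). [cite: PineauVicol2026, Conj. 1.1, Theorem 1.4, Remark 1.3; ChaeWolf2017RemovingDSS, §3] -/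
theorem rssCompact_exists_minimal_constant :
    (∃ (C₀ α : ℝ) (u : ℝ → EuclideanSpace ℝ (Fin 3) → EuclideanSpace ℝ (Fin 3)) (p : ℝ → EuclideanSpace ℝ (Fin 3) → ℝ) (U : EuclideanSpace ℝ (Fin 3) → EuclideanSpace ℝ (Fin 3)), Literature.Analysis.FluidPDE.IsClassicalNSSolutionOn (Set.Ico (-1) 0) 1 0 u p ∧ (∀ t ∈ Set.Ico (-1 : ℝ) 0, ∀ x : EuclideanSpace ℝ (Fin 3), ‖u t x‖ ≤ C₀ / (‖x‖ + Real.sqrt (-t))) ∧ ContDiff ℝ 2 U ∧ (∀ t ∈ Set.Ico (-1 : ℝ) 0, ∀ x : EuclideanSpace ℝ (Fin 3), u t x = Literature.Analysis.FluidPDE.pvAnsatz α (fun y _ => U y) t x) ∧ U ≠ 0) → ∃ Cstar αstar : ℝ, 0 < Cstar ∧ (∃ (u : ℝ → EuclideanSpace ℝ (Fin 3) → EuclideanSpace ℝ (Fin 3)) (p : ℝ → EuclideanSpace ℝ (Fin 3) → ℝ) (U : EuclideanSpace ℝ (Fin 3) → EuclideanSpace ℝ (Fin 3)), Literature.Analysis.FluidPDE.IsClassicalNSSolutionOn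 (Set.Ico (-1) 0) 1 0 u p ∧ (∀ t ∈ Set.Ico (-1 : ℝ) 0, ∀ x : EuclideanSpace ℝ (Fin 3), ‖u t x‖ ≤ Cstar / (‖x‖ + Real.sqrt (-t))) ∧ ContDiff ℝ 2 U ∧ (∀ t ∈ Set.Ico (-1 : ℝ) 0, ∀ x : EuclideanSpace ℝ (Fin 3), u t x = Literature.Analysis.FluidPDE.pvAnsatz αstar (fun y _ => U y) t x) ∧ U ≠ 0) ∧ ∀ (C₀ α : ℝ) (u : ℝ → EuclideanSpace ℝ (Fin 3) → EuclideanSpace ℝ (Fin 3)) (p : ℝ → EuclideanSpace ℝ (Fin 3) → ℝ) (U : EuclideanSpace ℝ (Fin 3) → EuclideanSpace ℝ (Fin 3)), Literature.Analysis.FluidPDE.IsClassicalNSSolutionOn (Set.Ico (-1) 0) 1 0 u p → (∀ t ∈ Set.Ico (-1 : ℝ) 0, ∀ x : EuclideanSpace ℝ (Fin 3), ‖u t x‖ ≤ C₀ / (‖x‖ + Real.sqrt (-t))) → ContDiff ℝ 2 U → (∀ t ∈ Set.Ico (-1 : ℝ) 0, ∀ x : EuclideanSpace ℝ (Fin 3),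 u t x = Literature.Analysis.FluidPDE.pvAnsatz α (fun y _ => U y) t x) → U ≠ 0 → Cstar ≤ C₀ := by
  intro hbad
  -- the set of bad constants
  set B : Set ℝ := {C₀ : ℝ | ∃ (α : ℝ) (u : ℝ → EuclideanSpace ℝ (Fin 3) → EuclideanSpace ℝ (Fin 3)) (p : ℝ → EuclideanSpace ℝ (Fin 3) → ℝ) (U : EuclideanSpace ℝ (Fin 3) → EuclideanSpace ℝ (Fin 3)),
        IsClassicalNSSolutionOn (Ico (-1) 0) 1 0 u p ∧
        (∀ t ∈ Ico (-1 : ℝ) 0, ∀ x : EuclideanSpace ℝ (Fin 3), ‖u t x‖ ≤ C₀ / (‖x‖ + Real.sqrt (-t))) ∧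
        ContDiff ℝ 2 U ∧
        (∀ t ∈ Ico (-1 : ℝ) 0, ∀ x : EuclideanSpace ℝ (Fin 3), u t x = pvAnsatz α (fun y _ => U y) t x) ∧ U ≠ 0} with hB
  obtain ⟨ε₀, hε₀, hgood⟩ := rssCompact_good_of_small_constant
  -- bad constants exceed `ε₀`
  have hBlow : ∀ C₀ ∈ B, ε₀ < C₀ := by
    intro C₀ hC
    obtain ⟨α, u, p, U, h1, h2, h3, h4, h5⟩ := hC
    have hC0 : 0 ≤ C₀ := by
      have h := h2 (-1) ⟨le_rfl, by norm_num⟩ 0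
      rw [norm_zero, zero_add, neg_neg, Real.sqrt_one, div_one] at h
      exact (norm_nonneg _).trans h
    by_contra hle
    exact h5 (hgood C₀ α hC0 (not_lt.1 hle) u p U h1 h2 h3 h4)
  have hne : B.Nonempty := by
    obtain ⟨C₀, α, u, p, U, h⟩ := hbad
    exact ⟨C₀, α, u, p, U, h⟩
  have hbdd : BddBelow B := ⟨ε₀, fun C hC => (hBlow C hC).le⟩
  obtain ⟨C, hanti, hClim, hCmem⟩ := exists_seq_tendsto_sInf hne hbdd
  set Cstar : ℝ := sInf B with hCstar
  -- speeds of a minimising sequence of bad pairs, bounded by the window at the largest constant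
  choose α u p U hsol hI hU2 hans hne' using hCmem
  have hCle : ∀ n, C n ≤ C 0 := fun n => hanti (Nat.zero_le n)
  have hC0pos : 0 < C 0 := hε₀.trans (hBlow _ ⟨α 0, u 0, p 0, U 0, hsol 0, hI 0, hU2 0, hans 0, hne' 0⟩)
  obtain ⟨α₁, α₂, -, -, hsub⟩ := rssCompact_bad_subset_window hC0pos
  have hαbd : ∀ n, α n ∈ Icc (-α₂) α₂ := by
    intro n
    have hmem : α n ∈ {α' : ℝ | ∃ (u : ℝ → EuclideanSpace ℝ (Fin 3) → EuclideanSpace ℝ (Fin 3)) (p : ℝ → EuclideanSpace ℝ (Fin 3) → ℝ) (U : EuclideanSpace ℝ (Fin 3) → EuclideanSpace ℝ (Fin 3)),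
        IsClassicalNSSolutionOn (Ico (-1) 0) 1 0 u p ∧
        (∀ t ∈ Ico (-1 : ℝ) 0, ∀ x : EuclideanSpace ℝ (Fin 3), ‖u t x‖ ≤ C 0 / (‖x‖ + Real.sqrt (-t))) ∧
        ContDiff ℝ 2 U ∧
        (∀ t ∈ Ico (-1 : ℝ) 0, ∀ x : EuclideanSpace ℝ (Fin 3), u t x = pvAnsatz α' (fun y _ => U y) t x) ∧ U ≠ 0} := by
      refine ⟨u n, p n, U n, hsol n, fun t ht x => (hI n t ht x).trans ?_, hU2 n, hans n, hne' n⟩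
      have hden : 0 < ‖x‖ + Real.sqrt (-t) := by
        have : 0 < Real.sqrt (-t) := Real.sqrt_pos.2 (by linarith [ht.2])
        positivity
      exact div_le_div_of_nonneg_right (hCle n) hden.le
    have h := (hsub hmem).2
    exact ⟨by linarith [neg_abs_le (α n)], le_trans (le_abs_self _) h⟩
  obtain ⟨αstar, -, φ, hφ, hαlim⟩ :=
    tendsto_subseq_of_bounded (Metric.isBounded_Icc (-α₂) α₂) hαbd
  have hClim' : Tendsto (C ∘ φ) atTop (𝓝 Cstar) := hClim.comp hφ.tendsto_atTop
  have hkey := rssCompact_not_liouvilleAt_of_tendsto (C ∘ φ) (α ∘ φ) Cstar αstar hClim' hαlim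
    fun n => ⟨u (φ n), p (φ n), U (φ n), hsol (φ n), hI (φ n), hU2 (φ n), hans (φ n), hne' (φ n)⟩
  have hstar_mem : Cstar ∈ B := by
    push Not at hkey
    obtain ⟨u', p', U', h1, h2, h3, h4, h5⟩ := hkey
    exact ⟨αstar, u', p', U', h1, h2, h3, h4, h5⟩
  refine ⟨Cstar, αstar, hε₀.trans (hBlow _ hstar_mem), ?_, fun C₀ α' u' p' U' h1 h2 h3 h4 h5 => ?_⟩
  · push Not at hkey
    obtain ⟨u', p', U', h1, h2, h3, h4, h5⟩ := hkey
    exact ⟨u', p', U', h1, h2, h3, h4, h5⟩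
  · exact csInf_le hbdd ⟨α', u', p', U', h1, h2, h3, h4, h5⟩



/-- **Window Liouville from OPENNESS of the bad set (clopen argument).** For `C₀ > 0`: if the set
of bad speeds at level `C₀` is OPEN in `ℝ`, it is empty — it is also compact
(`rssCompact_isCompact_bad`), hence clopen in the connected line, and it is not all of `ℝ` (the
speed `0` is never bad: Theorem 1.4, `rssCompact_bad_subset_window`). So a perturbation theory of
counterexamples AT FIXED CONSTANT (every non-trivial Type-I RSS profile of speed `α` continues to all
nearby speeds without increasing its Type-I constant) would settle Conj. 1.1 at that level. [cite: PineauVicol2026, Conj. 1.1 and Theorem 1.4; ChaeWolf2017RemovingDSS, §3] -/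
theorem rssCompact_liouville_of_isOpen_bad (C₀ : ℝ) (hC₀ : 0 < C₀)
    (hopen : IsOpen {α : ℝ | ∃ (u : ℝ → EuclideanSpace ℝ (Fin 3) → EuclideanSpace ℝ (Fin 3)) (p : ℝ → EuclideanSpace ℝ (Fin 3) → ℝ) (U : EuclideanSpace ℝ (Fin 3) → EuclideanSpace ℝ (Fin 3)),
        IsClassicalNSSolutionOn (Ico (-1) 0) 1 0 u p ∧
        (∀ t ∈ Ico (-1 : ℝ) 0, ∀ x : EuclideanSpace ℝ (Fin 3), ‖u t x‖ ≤ C₀ / (‖x‖ + Real.sqrt (-t))) ∧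
        ContDiff ℝ 2 U ∧
        (∀ t ∈ Ico (-1 : ℝ) 0, ∀ x : EuclideanSpace ℝ (Fin 3), u t x = pvAnsatz α (fun y _ => U y) t x) ∧ U ≠ 0}) :
    ∀ (α : ℝ) (u : ℝ → EuclideanSpace ℝ (Fin 3) → EuclideanSpace ℝ (Fin 3)) (p : ℝ → EuclideanSpace ℝ (Fin 3) → ℝ) (U : EuclideanSpace ℝ (Fin 3) → EuclideanSpace ℝ (Fin 3)),
        IsClassicalNSSolutionOn (Ico (-1) 0) 1 0 u p →
        (∀ t ∈ Ico (-1 : ℝ) 0, ∀ x : EuclideanSpace ℝ (Fin 3), ‖u t x‖ ≤ C₀ / (‖x‖ + Real.sqrt (-t))) →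
        ContDiff ℝ 2 U →
        (∀ t ∈ Ico (-1 : ℝ) 0, ∀ x : EuclideanSpace ℝ (Fin 3), u t x = pvAnsatz α (fun y _ => U y) t x) → U = 0 := by
  intro α u p U h1 h2 h3 h4
  by_contra h5
  have hclopen : IsClopen {α : ℝ | ∃ (u : ℝ → EuclideanSpace ℝ (Fin 3) → EuclideanSpace ℝ (Fin 3)) (p : ℝ → EuclideanSpace ℝ (Fin 3) → ℝ) (U : EuclideanSpace ℝ (Fin 3) → EuclideanSpace ℝ (Fin 3)),
        IsClassicalNSSolutionOn (Ico (-1) 0) 1 0 u p ∧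
        (∀ t ∈ Ico (-1 : ℝ) 0, ∀ x : EuclideanSpace ℝ (Fin 3), ‖u t x‖ ≤ C₀ / (‖x‖ + Real.sqrt (-t))) ∧
        ContDiff ℝ 2 U ∧
        (∀ t ∈ Ico (-1 : ℝ) 0, ∀ x : EuclideanSpace ℝ (Fin 3), u t x = pvAnsatz α (fun y _ => U y) t x) ∧ U ≠ 0} :=
    ⟨(rssCompact_isCompact_bad C₀ hC₀).isClosed, hopen⟩
  rcases isClopen_iff.1 hclopen with hempty | huniv
  · have hmem : α ∈ (∅ : Set ℝ) := by
      rw [← hempty]; exact ⟨u, p, U, h1, h2, h3, h4, h5⟩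
    exact hmem
  · obtain ⟨α₁, α₂, hα₁, -, hsub⟩ := rssCompact_bad_subset_window hC₀
    have h0 : (0 : ℝ) ∈ (univ : Set ℝ) := mem_univ _
    rw [← huniv] at h0
    have := (hsub h0).1
    rw [abs_zero] at this
    exact (lt_irrefl _) (lt_of_lt_of_le hα₁ this)

/-- **The bad set is symmetric under `α ↦ −α`.** A speed `α` is bad at level `C₀` iff `−α` is
(the meridian reflection `reflY` conjugates `R(θ)` to `R(−θ)` and maps Type-I RSS solutions of
speed `α` to Type-I RSS solutions of speed `−α` with the same constant:
`rssCompact_liouvilleAt_neg`). Hence extremal bad speeds may be taken positive. [cite: PineauVicol2026, §1.2 (1.6)–(1.7); MajdaBertozziCUP2002, §1.2 Prop. 1.1 (iii)] -/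
theorem rssCompact_bad_neg_iff (C₀ α : ℝ) :
    (∃ (u : ℝ → EuclideanSpace ℝ (Fin 3) → EuclideanSpace ℝ (Fin 3)) (p : ℝ → EuclideanSpace ℝ (Fin 3) → ℝ) (U : EuclideanSpace ℝ (Fin 3) → EuclideanSpace ℝ (Fin 3)),
        IsClassicalNSSolutionOn (Ico (-1) 0) 1 0 u p ∧
        (∀ t ∈ Ico (-1 : ℝ) 0, ∀ x : EuclideanSpace ℝ (Fin 3), ‖u t x‖ ≤ C₀ / (‖x‖ + Real.sqrt (-t))) ∧
        ContDiff ℝ 2 U ∧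
        (∀ t ∈ Ico (-1 : ℝ) 0, ∀ x : EuclideanSpace ℝ (Fin 3), u t x = pvAnsatz (-α) (fun y _ => U y) t x) ∧ U ≠ 0) ↔
    (∃ (u : ℝ → EuclideanSpace ℝ (Fin 3) → EuclideanSpace ℝ (Fin 3)) (p : ℝ → EuclideanSpace ℝ (Fin 3) → ℝ) (U : EuclideanSpace ℝ (Fin 3) → EuclideanSpace ℝ (Fin 3)),
        IsClassicalNSSolutionOn (Ico (-1) 0) 1 0 u p ∧
        (∀ t ∈ Ico (-1 : ℝ) 0, ∀ x : EuclideanSpace ℝ (Fin 3), ‖u t x‖ ≤ C₀ / (‖x‖ + Real.sqrt (-t))) ∧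
        ContDiff ℝ 2 U ∧
        (∀ t ∈ Ico (-1 : ℝ) 0, ∀ x : EuclideanSpace ℝ (Fin 3), u t x = pvAnsatz α (fun y _ => U y) t x) ∧ U ≠ 0) := by
  constructor
  · rintro ⟨u, p, U, h1, h2, h3, h4, h5⟩
    by_contra hgood
    have hgood' : ∀ (u : ℝ → EuclideanSpace ℝ (Fin 3) → EuclideanSpace ℝ (Fin 3)) (p : ℝ → EuclideanSpace ℝ (Fin 3) → ℝ) (U : EuclideanSpace ℝ (Fin 3) → EuclideanSpace ℝ (Fin 3)),
        IsClassicalNSSolutionOn (Ico (-1) 0) 1 0 u p →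
        (∀ t ∈ Ico (-1 : ℝ) 0, ∀ x : EuclideanSpace ℝ (Fin 3), ‖u t x‖ ≤ C₀ / (‖x‖ + Real.sqrt (-t))) →
        ContDiff ℝ 2 U →
        (∀ t ∈ Ico (-1 : ℝ) 0, ∀ x : EuclideanSpace ℝ (Fin 3), u t x = pvAnsatz α (fun y _ => U y) t x) → U = 0 := by
      intro u' p' U' g1 g2 g3 g4
      by_contra g5
      exact hgood ⟨u', p', U', g1, g2, g3, g4, g5⟩
    exact h5 (rssCompact_liouvilleAt_neg C₀ α hgood' u p U h1 h2 h3 h4)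
  · rintro ⟨u, p, U, h1, h2, h3, h4, h5⟩
    by_contra hgood
    have hgood' : ∀ (u : ℝ → EuclideanSpace ℝ (Fin 3) → EuclideanSpace ℝ (Fin 3)) (p : ℝ → EuclideanSpace ℝ (Fin 3) → ℝ) (U : EuclideanSpace ℝ (Fin 3) → EuclideanSpace ℝ (Fin 3)),
        IsClassicalNSSolutionOn (Ico (-1) 0) 1 0 u p →
        (∀ t ∈ Ico (-1 : ℝ) 0, ∀ x : EuclideanSpace ℝ (Fin 3), ‖u t x‖ ≤ C₀ / (‖x‖ + Real.sqrt (-t))) →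
        ContDiff ℝ 2 U →
        (∀ t ∈ Ico (-1 : ℝ) 0, ∀ x : EuclideanSpace ℝ (Fin 3), u t x = pvAnsatz (-α) (fun y _ => U y) t x) → U = 0 := by
      intro u' p' U' g1 g2 g3 g4
      by_contra g5
      exact hgood ⟨u', p', U', g1, g2, g3, g4, g5⟩
    have h := rssCompact_liouvilleAt_neg C₀ (-α) hgood' u p U h1 h2 h3
    rw [neg_neg] at h
    exact h5 (h h4)

/-- **Conj. 1.1 by DESCENT in the Type-I constant.** If every pair `(C₀, α)` carrying a non-trivial
Type-I RSS classical solution of Pineau–Vicol's class admits such a pair with a STRICTLY SMALLER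
constant, then no such pair exists: Conj. 1.1 holds in that class at every level and every speed
(a pair with minimal constant would exist by `rssCompact_exists_minimal_constant`). [cite: PineauVicol2026, Conj. 1.1; ChaeWolf2017RemovingDSS, §3] -/
theorem rssCompact_liouville_of_descent_constant
    (hdesc : ∀ (C₀ α : ℝ) (u : ℝ → EuclideanSpace ℝ (Fin 3) → EuclideanSpace ℝ (Fin 3)) (p : ℝ → EuclideanSpace ℝ (Fin 3) → ℝ) (U : EuclideanSpace ℝ (Fin 3) → EuclideanSpace ℝ (Fin 3)),
        IsClassicalNSSolutionOn (Ico (-1) 0) 1 0 u p →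
        (∀ t ∈ Ico (-1 : ℝ) 0, ∀ x : EuclideanSpace ℝ (Fin 3), ‖u t x‖ ≤ C₀ / (‖x‖ + Real.sqrt (-t))) →
        ContDiff ℝ 2 U →
        (∀ t ∈ Ico (-1 : ℝ) 0, ∀ x : EuclideanSpace ℝ (Fin 3), u t x = pvAnsatz α (fun y _ => U y) t x) → U ≠ 0 →
        ∃ (C₀' α' : ℝ) (u' : ℝ → EuclideanSpace ℝ (Fin 3) → EuclideanSpace ℝ (Fin 3)) (p' : ℝ → EuclideanSpace ℝ (Fin 3) → ℝ) (U' : EuclideanSpace ℝ (Fin 3) → EuclideanSpace ℝ (Fin 3)), C₀' < C₀ ∧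
          IsClassicalNSSolutionOn (Ico (-1) 0) 1 0 u' p' ∧
          (∀ t ∈ Ico (-1 : ℝ) 0, ∀ x : EuclideanSpace ℝ (Fin 3), ‖u' t x‖ ≤ C₀' / (‖x‖ + Real.sqrt (-t))) ∧
          ContDiff ℝ 2 U' ∧
          (∀ t ∈ Ico (-1 : ℝ) 0, ∀ x : EuclideanSpace ℝ (Fin 3), u' t x = pvAnsatz α' (fun y _ => U' y) t x) ∧ U' ≠ 0) :
    ∀ (C₀ α : ℝ) (u : ℝ → EuclideanSpace ℝ (Fin 3) → EuclideanSpace ℝ (Fin 3)) (p : ℝ → EuclideanSpace ℝ (Fin 3) → ℝ) (U : EuclideanSpace ℝ (Fin 3) → EuclideanSpace ℝ (Fin 3)),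
        IsClassicalNSSolutionOn (Ico (-1) 0) 1 0 u p →
        (∀ t ∈ Ico (-1 : ℝ) 0, ∀ x : EuclideanSpace ℝ (Fin 3), ‖u t x‖ ≤ C₀ / (‖x‖ + Real.sqrt (-t))) →
        ContDiff ℝ 2 U →
        (∀ t ∈ Ico (-1 : ℝ) 0, ∀ x : EuclideanSpace ℝ (Fin 3), u t x = pvAnsatz α (fun y _ => U y) t x) → U = 0 := by
  intro C₀ α u p U h1 h2 h3 h4
  by_contra h5
  obtain ⟨Cstar, αstar, -, ⟨u', p', U', g1, g2, g3, g4, g5⟩, hmin⟩ :=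
    rssCompact_exists_minimal_constant ⟨C₀, α, u, p, U, h1, h2, h3, h4, h5⟩
  obtain ⟨C'', α'', u'', p'', U'', hlt, k1, k2, k3, k4, k5⟩ := hdesc Cstar αstar u' p' U' g1 g2 g3 g4 g5
  exact (lt_irrefl _) (lt_of_lt_of_le hlt (hmin C'' α'' u'' p'' U'' k1 k2 k3 k4 k5))

/-- **The bad set is closed in the `(C₀, α)` plane.** The set of pairs `(C₀, α)` carrying a
non-trivial Type-I (constant `C₀`) RSS classical solution of Pineau–Vicol's class with speed `α`
is a closed subset of `ℝ²` (sequentially closed by `rssCompact_not_liouvilleAt_of_tendsto`). [cite: ChaeWolf2017RemovingDSS, §3; PineauVicol2026, Theorem 1.4 (class)] -/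
theorem rssCompact_isClosed_bad_pairs :
    IsClosed {q : ℝ × ℝ | ∃ (u : ℝ → EuclideanSpace ℝ (Fin 3) → EuclideanSpace ℝ (Fin 3)) (p : ℝ → EuclideanSpace ℝ (Fin 3) → ℝ) (U : EuclideanSpace ℝ (Fin 3) → EuclideanSpace ℝ (Fin 3)),
        IsClassicalNSSolutionOn (Ico (-1) 0) 1 0 u p ∧
        (∀ t ∈ Ico (-1 : ℝ) 0, ∀ x : EuclideanSpace ℝ (Fin 3), ‖u t x‖ ≤ q.1 / (‖x‖ + Real.sqrt (-t))) ∧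
        ContDiff ℝ 2 U ∧
        (∀ t ∈ Ico (-1 : ℝ) 0, ∀ x : EuclideanSpace ℝ (Fin 3), u t x = pvAnsatz q.2 (fun y _ => U y) t x) ∧ U ≠ 0} := by
  refine IsSeqClosed.isClosed fun q q₀ hq hlim => ?_
  have hC : Tendsto (fun n => (q n).1) atTop (𝓝 q₀.1) := (continuous_fst.tendsto q₀).comp hlim
  have hα : Tendsto (fun n => (q n).2) atTop (𝓝 q₀.2) := (continuous_snd.tendsto q₀).comp hlim
  have hkey := rssCompact_not_liouvilleAt_of_tendsto (fun n => (q n).1) (fun n => (q n).2) q₀.1 q₀.2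
    hC hα fun n => hq n
  push Not at hkey
  obtain ⟨u, p, U, h1, h2, h3, h4, h5⟩ := hkey
  exact ⟨u, p, U, h1, h2, h3, h4, h5⟩

end Pairs

end Summit.NavierStokesRegularity.NavierStokesRegularity.Theorems

end
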